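import Literature.MathematicalPhysics.QuantumFieldTheory.Balaban1983to89.B1Eq324BenfattoKernelSect5StepBoundUpper
import Literature.MathematicalPhysics.QuantumFieldTheory.Balaban1983to89.B1Eq324BenfattoKernelSect5UnionCentreRows
import Literature.MathematicalPhysics.QuantumFieldTheory.Balaban1983to89.B1Eq324BenfattoKernelSect5PartFieldRows
import Literature.MathematicalPhysics.QuantumFieldTheory.Balaban1983to89.B1Eq324BenfattoKernelSect5ClassRows
import HarnessLib

/-!
# `Balaban1983to89.B1Eq324BenfattoKernelSect5ClassUpperStep` — [BenfattoEtAl1978] §5 pp. 155–159, (5.36) p. 159: ONE UPPER PAVEMENT STEP OF THE CLASS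
# ROAD WITH THE DEPTH ROWS DISCHARGED FROM THE CLASS CONSTANTS, standard position — the per-step input of the class UPPER pavement chain (`hbox`,
# conditioning `C ∪ Γ₁`) and of (4.6)'s collection of errors (`hE`), produced from the class rows of [Balaban1985BackgroundPropagators] Sect. E only
# (the mirror of `…KernelSect5ClassLowerStep`)

statement-level skeleton of published theorems with citation tags; proofs where landed; nothing here is a claim about the
Yang–Mills mass gap

WHY THIS MODULE (cell `pub-ymgap`, seat `dag-n08-c` gen 31; node N08 [Balaban1985UV3]; the [BenfattoEtAl1978] source chain behind the (α)-row `h324`;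
the (4.6) side of the ASSEMBLY layer over seat n08-d's class upper chain `…KernelSect5PavementChainUpper.upperPavementChainCond(_le_exp)` (p619737)).
My `…KernelSect5StepBoundUpper.exists_upper_step` produces, at ONE class member in standard position with an extra conditioning set `C` missing the
parts, per-box exponents `u(□)` with (hbox) the per-box UPPER bounds (set-integral currency, centre `condMean K (C ∪ Γ₁) ξ`) and (hE) the upper
identification with CLOSED errors — under DISPLAYED depth rows.  The kernel rows (a), (b), (e), (f)-kernel are discharged exactly as on the lower side
(seat n08-w5 `…KernelSect5PartFieldRows`); the CENTRE rows for the union conditioning — (c′) on `I`, (d′) at depth, (f′) on `□′∪Γ₂(□)` — are seat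
n08-d's `…KernelSect5UnionCentreRows` (the decaying F5 split into the `Γ₁`-part and the far `C`-part), read at `dist := |·−·|₂` with the far premise
`|x − c|₂ ≥ R` on the boxes.  The constant ties become `(1 + M₂V₄/(γ_A−J_c)(γ+1))·b ≤ Kᵤ ≤ K₀`, `1/(γ_A−J_c) ≤ K₀`, the two depth budgets
`≤ ε₃₁` ((e) as before; (d′) with the far term `e^{−(θ/4)R}`), `1/γ_A ≤ ½`, and the Lemma-2 centre condition of the upper side
`(M₂V₄/(γ_A−J_c))(γ + e^{−(θ/4)R}) ≤ ½` (print: `γ` small, `R = b³`).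

WHAT IS PROVED (theorems only; no definition, no named fact, no `sorry`; axioms standard).
* ★★ `exists_upper_step_of_classRows` — ∃ `u`: (hbox, upper, conditioning `C ∪ Γ₁`) ∧ (hE, upper, closed), at a class member in standard position,
  every depth row discharged from the class rows (`Λ ≠ ∅`).

HONEST SCOPE / NOT HERE.  The frame edition (`C_k`, `z̄_k`, n08-d's `partKernel_row_sdiff_of_disjoint` for the parts) and the knit over
`upperPavementChainCond_le_exp` + `…CollectErrors.le_exp_cumulantSum_add_of_chain` are the sequel; the class and its rows are OURS; one self-located
piece of an UNCOMMISSIONED port (plan g81 (II), START-LIST v11 §n08) — nothing chained; no generalised Basic Lemma is stated; nothing of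
[Balaban1985UV3] is asserted; count-neutral for N08; nothing about d = 4, the continuum, OS axioms, a mass gap or the Clay problem.
-/

noncomputable section

open MeasureTheory ProbabilityTheory Finset Matrix
open scoped BigOperators Nat NNReal

namespace Literature.MathematicalPhysics.QuantumFieldTheory.Balaban1983to89.B1Eq324BenfattoKernelSect5ClassUpperStep

open _root_.MeasureTheory _root_.ProbabilityTheory
open Literature.Probability.LatticeModels (setPartitions)
open Literature.MathematicalPhysics.QuantumFieldTheory
open Literature.MathematicalPhysics.QuantumFieldTheory.Balaban1983to89.B1Eq324BenfattoLemma
open Literature.MathematicalPhysics.QuantumFieldTheory.Balaban1983to89.B1Eq324BenfattoSect5Boxes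
open Literature.MathematicalPhysics.QuantumFieldTheory.Balaban1983to89.B1Eq324BenfattoSect5Eq511
open Literature.MathematicalPhysics.QuantumFieldTheory.Balaban1983to89.B1Eq324BenfattoSect5Eq524
open Literature.MathematicalPhysics.QuantumFieldTheory.Balaban1983to89.B1Eq324BenfattoSect5Eq534
open Literature.MathematicalPhysics.QuantumFieldTheory.Balaban1983to89.B1Eq324BenfattoSect5Eq515
open Literature.MathematicalPhysics.QuantumFieldTheory.Balaban1983to89.B1Eq324BenfattoSect5Iteration (restrictCoef shiftCoef)
open Literature.MathematicalPhysics.QuantumFieldTheory.Balaban1983to89.B1Eq324BenfattoClassAppendixC (posDef_of_coercive)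
open Literature.MathematicalPhysics.QuantumFieldTheory.Balaban1983to89.B1Eq324BenfattoKernelSect5StepBoundUpper (exists_upper_step)
open Literature.MathematicalPhysics.QuantumFieldTheory.Balaban1983to89.B1Eq324BenfattoKernelSect5UnionCentreRows
  (abs_condMean_union_le_profile_on_shrink abs_condMean_union_le_deep abs_condMean_union_le_on_region)
open Literature.MathematicalPhysics.QuantumFieldTheory.Balaban1983to89.B1Eq324BenfattoCondCentre (condMean_apply_of_mem)
open Literature.MathematicalPhysics.QuantumFieldTheory.Balaban1983to89.B1Eq324BenfattoKernelOfPrecision (isUnit_det_covGram_kernel condMean_kernel_eq_zero_of_not_mem)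
open Literature.MathematicalPhysics.QuantumFieldTheory.Balaban1983to89.B1Eq324BenfattoKernelSect5PartFieldRows
open Literature.MathematicalPhysics.QuantumFieldTheory.Balaban1983to89.B1Eq324BenfattoKernelSect5ClassRows (l2_self l2_comm l2_triangle)
open Literature.MathematicalPhysics.QuantumFieldTheory.Balaban1983to89.B1Eq324GaussianMomentLeaf (momentConst)

variable {d : ℕ}

/-! ## §0  A kernel: a displayed row constant is non-negative -/

/-- kernel: a row bound of a non-negative weight over a non-empty index set is non-negative. [folklore] -/
private theorem const_nonneg_of_row {Λ : Finset (B1Eq324BenfattoLemma.Site d)} (hΛ : Λ.Nonempty) {f : ↥Λ → ↥Λ → ℝ} {C : ℝ}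
    (hf : ∀ e e', 0 ≤ f e e') (hC : ∀ e : Λ, ∑ e' : Λ, f e e' ≤ C) : 0 ≤ C := by
  obtain ⟨x, hx⟩ := hΛ
  exact le_trans (Finset.sum_nonneg fun e' _ => hf ⟨x, hx⟩ e') (hC ⟨x, hx⟩)


/-! ## §1  One upper step from the class rows, standard position -/

section Standard

variable {Λ : Finset (B1Eq324BenfattoLemma.Site d)} {A : Matrix Λ Λ ℝ}
  {K : B1Eq324BenfattoLemma.Site d → B1Eq324BenfattoLemma.Site d → ℝ}
  (hK : ∀ x y, K x y = if h : x ∈ Λ ∧ y ∈ Λ then (A⁻¹ : Matrix Λ Λ ℝ) ⟨x, h.1⟩ ⟨y, h.2⟩ else 0)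
  {s D : ℕ} {κ : ℝ} {a : Coef d} {J I : Finset (B1Eq324BenfattoLemma.Site d)} {L w v : ℕ} {γ b Ac : ℝ}
  (hBΛ : ∀ m ∈ (J.image (boxIndex L)), box L m ⊆ Λ)
  {Kb : B1Eq324BenfattoLemma.Site d → B1Eq324BenfattoLemma.Site d → B1Eq324BenfattoLemma.Site d → ℝ}
  (hKb : ∀ m (hm : m ∈ (J.image (boxIndex L))) x y, Kb m x y = if h : x ∈ shrink L m w ∧ y ∈ shrink L m w then
    ((A.submatrix (fun j : ↥(shrink L m w) => (⟨j, hBΛ m hm (shrink_subset_box L m w j.2)⟩ : Λ))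
      (fun j : ↥(shrink L m w) => (⟨j, hBΛ m hm (shrink_subset_box L m w j.2)⟩ : Λ)))⁻¹ :
        Matrix ↥(shrink L m w) ↥(shrink L m w) ℝ) ⟨x, h.1⟩ ⟨y, h.2⟩ else 0)

include hK hKb

set_option maxHeartbeats 400000 in -- the closed error terms of `exists_upper_step` are very large; the row discharges add up
/-- ★★ **ONE UPPER STEP OF THE CLASS ROAD FROM THE CLASS ROWS, STANDARD POSITION.**  At a class member `(Λ, A, K)` (`Λ ≠ ∅`; `A` symmetric
`γ_A`-coercive; Euclidean Combes–Thomas row `J_c < γ_A` at rate `θ > 0`; half-rate rows `V₂`, `M₂`; quarter-rate growth row `V₄`) carrying a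
standard-position datum (`A` supported in `J ⊆ I`, `|A| ≤ A_c`, `b ≥ 1`, `0 ≤ γ ≤ 1`), print's pavement (`2(2w+v) < L`, `v ≤ w`, `L^d e^{−b²/4} ≤ 1/6`)
with `B = J.image boxIndex`, corridors and boxes inside `Λ`, an extra conditioning set `C ⊆ Λ` missing every `□′∪Γ₂(□)` and `|·−·|₂`-far (`≥ R`) from
every box, the definitional part-kernel row, and the constant ties displayed in the module docstring: THERE ARE per-box exponents `u(□)` with (hbox)
`∫_{χ^□_b}e^{Ψ_□}dN ≤ e^{u(□)}·∫_{χ^□_b}e^{Ψ′₁+Ψ₂}dN`, `N = 𝒩(u_{C∪Γ₁}(ξ), Kb □)`, for every `□ ∈ B` and every `ξ` `γb`-small on `Γ₁` and `b`-small on `C`,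
and (hE) `Σ_□u(□) ≤ cumulantSum μ_K H_J t − cumulantSum μ_K H_{Γ̄₁} t + (Σ_□Err(□) + CUMB)`, errors CLOSED — `…StepBoundUpper.exists_upper_step` with rows
(a)(b)(e)(f)-kernel from `…KernelSect5PartFieldRows` and the centre rows (c′)(d′)(f′) from `…KernelSect5UnionCentreRows` BY NAME.
[cite: BenfattoEtAl1978, §5 (5.16)–(5.36) pp.155–159, (4.6) p.152, Appendix C pp.164–165 (class form); Balaban1985BackgroundPropagators, (1.16)–(1.18) p.180] -/
theorem exists_upper_step_of_classRows (hΛ : Λ.Nonempty)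
    (hAs : ∀ e e', A e e' = A e' e) {γA : ℝ} (hγA0 : 0 < γA)
    (hγA : ∀ x : Λ → ℝ, γA * ∑ e, x e ^ 2 ≤ ∑ e, ∑ e', A e e' * x e * x e')
    {θ Jc V₂ M₂ V₄ : ℝ} (hθ : 0 < θ)
    (hJc : ∀ e : Λ, ∑ e' : Λ, |A e e'| * (Real.cosh (θ * Real.sqrt (∑ j, ((((e : B1Eq324BenfattoLemma.Site d) j : ℝ) - ((e' : B1Eq324BenfattoLemma.Site d) j : ℝ))) ^ 2)) - 1) ≤ Jc)
    (hJcγ : Jc < γA)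
    (hV₂ : ∀ e : Λ, ∑ e' : Λ, Real.exp (-(θ / 2 * Real.sqrt (∑ j, ((((e : B1Eq324BenfattoLemma.Site d) j : ℝ) - ((e' : B1Eq324BenfattoLemma.Site d) j : ℝ))) ^ 2))) ≤ V₂)
    (hM₂ : ∀ e : Λ, ∑ e' : Λ, |A e e'| * Real.exp (θ / 2 * Real.sqrt (∑ j, ((((e : B1Eq324BenfattoLemma.Site d) j : ℝ) - ((e' : B1Eq324BenfattoLemma.Site d) j : ℝ))) ^ 2)) ≤ M₂)
    (hV₄ : ∀ e : Λ, ∑ e' : Λ, Real.exp (-(θ / 4 * Real.sqrt (∑ j, ((((e : B1Eq324BenfattoLemma.Site d) j : ℝ) - ((e' : B1Eq324BenfattoLemma.Site d) j : ℝ))) ^ 2))) *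
      (1 + Real.sqrt (∑ j, ((((e : B1Eq324BenfattoLemma.Site d) j : ℝ) - ((e' : B1Eq324BenfattoLemma.Site d) j : ℝ))) ^ 2)) ≤ V₄)
    (hκ : 0 < κ) (hJ : CoefSupportedIn a J) (hJI : J ⊆ I) (hAc0 : 0 ≤ Ac)
    (hA : ∀ (p : ℕ) (Δ : Fin p → B1Eq324BenfattoLemma.Site d) (n : Fin p → ℕ), |a p Δ n| ≤ Ac)
    (hL2 : 2 * (2 * w + v) < L) (hv : v ≤ w) (hb : 1 ≤ b) (hγ0 : 0 ≤ γ) (hγ1 : γ ≤ 1)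
    (hsmall : ((L : ℝ) ^ d) * Real.exp (-(b ^ 2 / 4)) ≤ 1 / 6)
    (hΓΛ : corridors L w (J.image (boxIndex L)) ⊆ Λ)
    {C : Finset (B1Eq324BenfattoLemma.Site d)} (hCΛ : C ⊆ Λ) (hCsh : ∀ m ∈ (J.image (boxIndex L)), Disjoint (shrink L m w) C) {R : ℝ}
    (hCfar : ∀ m ∈ (J.image (boxIndex L)), ∀ x ∈ box L m, ∀ c ∈ C, R ≤ Real.sqrt (∑ j, (((x j : ℝ) - (c j : ℝ))) ^ 2))
    {Ku K₀ ε₃₁ : ℝ} (hKuI : (1 + M₂ * V₄ / (γA - Jc) * (γ + 1)) * b ≤ Ku) (hKuK : Ku ≤ K₀) (hK₀ : 1 / (γA - Jc) ≤ K₀) (hK₀1 : 1 ≤ K₀)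
    (hε₁ : V₂ * M₂ / (γA - Jc) ^ 2 * Real.exp (-(θ / 2 * ((w - v : ℕ) : ℝ))) + Real.exp (-(θ * ((w - v : ℕ) : ℝ))) / (γA - Jc) ≤ ε₃₁)
    (hε₂ : M₂ * V₄ / (γA - Jc) * (γ * Real.exp (-(θ / 4 * ((w - v : ℕ) : ℝ))) + Real.exp (-(θ / 4 * R))) * b *
      (1 + Real.sqrt d * ((L : ℝ) - 1)) ≤ ε₃₁)
    (hhalf : 1 / γA ≤ 1 / 2) (hsmallU : M₂ * V₄ / (γA - Jc) * (γ + Real.exp (-(θ / 4 * R))) ≤ 1 / 2)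
    {δ : ℝ} (hδ : 0 < δ) (hδle : δ ≤ θ / Real.sqrt d) (hres : 0 < κ / 2 - δ / 2 * ((D : ℝ) ^ 2 * Real.sqrt d)) (t : ℕ) :
    ∃ u : B1Eq324BenfattoLemma.Site d → ℝ,
      (∀ m ∈ (J.image (boxIndex L)), ∀ ξ : B1Eq324BenfattoLemma.Site d → ℝ,
        ξ ∈ smallFieldOn (corridors L w (J.image (boxIndex L)) : Set (B1Eq324BenfattoLemma.Site d)) I (γ * b) →
        ξ ∈ smallFieldOn ((C : Finset (B1Eq324BenfattoLemma.Site d)) : Set (B1Eq324BenfattoLemma.Site d)) I b →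
        ∫ z in smallFieldOn (shrink L m w : Set (B1Eq324BenfattoLemma.Site d)) I b,
            Real.exp (psiBox s D κ a L w m z) ∂((gaussianFieldOfKernel (Kb m)).map
              fun (ζ : B1Eq324BenfattoLemma.Site d → ℝ) (x : B1Eq324BenfattoLemma.Site d) => condMean K (C ∪ corridors L w (J.image (boxIndex L))) ξ x + ζ x)
          ≤ Real.exp (u m) * ∫ z in smallFieldOn (shrink L m w : Set (B1Eq324BenfattoLemma.Site d)) I b,
            Real.exp (psi1p s D κ a L w v m z + psi2 s D κ a L w m z) ∂((gaussianFieldOfKernel (Kb m)).map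
              fun (ζ : B1Eq324BenfattoLemma.Site d → ℝ) (x : B1Eq324BenfattoLemma.Site d) => condMean K (C ∪ corridors L w (J.image (boxIndex L))) ξ x + ζ x)) ∧
      (∑ m ∈ (J.image (boxIndex L)), u m ≤
        (cumulantSum (gaussianFieldOfKernel K) (hamiltonian s D κ a J) t - cumulantSum (gaussianFieldOfKernel K) (hamiltonian s D κ a (corridorsBar L w v (J.image (boxIndex L)))) t)
          + (∑ m ∈ (J.image (boxIndex L)),
              (2 * (2 ^ ((t + 1).choose 2) * (4 * (s1Const s D d κ * Ac * b ^ D * (L : ℝ) ^ d)) ^ (t + 1) / (t + 1)!) +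
                    Real.exp (2 * (4 * (s1Const s D d κ * Ac * b ^ D * (L : ℝ) ^ d))) *
                      (3 * (((shrink L m w).card : ℝ) * Real.exp (-(b ^ 2 / 4)))) +
                    ∑ k ∈ Finset.range t,
                      (3 ^ (k + 1) * ((∑ π ∈ setPartitions (univ : Finset (Fin (k + 1))), ((π.card - 1)! : ℝ)) *
                          (s1Const s D d κ * Ac * b ^ D * Real.exp (-(κ / 4 * v)) * (L : ℝ) ^ d *
                            (4 * (s1Const s D d κ * Ac * b ^ D * (L : ℝ) ^ d)) ^ k)) +
                        3 ^ (k + 1) * (2 ^ (k + 1) * ((∑ π ∈ setPartitions (univ : Finset (Fin (k + 1))), ((π.card - 1)! : ℝ)) *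
                            ((min 1 (2 * ((shrink L m w).card : ℝ) * Real.exp (-(b ^ 2 / 4)))) ^ ((2 * (k + 1) : ℕ) : ℝ)⁻¹ *
                              ((1 + Ku) ^ D * (Ac * (L : ℝ) ^ d * ∑ p ∈ Finset.Icc 1 s, ((admissible p D).card : ℝ) *
              ((2 / (1 - Real.exp (-(κ / 2 / (p : ℕ) / Real.sqrt d))) * Real.exp (κ / 2 / (p : ℕ) / Real.sqrt d)) ^ d) ^ (p - 1)) * momentConst D (2 * (k + 1)) K₀.toNNReal) ^ (k + 1))) +
                          2 ^ ((k + 1) * D) * 2 ^ 2 ^ ((k + 1) * D) * K₀ ^ ((k + 1) * D) * Real.exp (-(δ / 2 * ((v : ℝ) + 1))) *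
                            (Ac * Real.exp (δ / 2 * ((D : ℝ) ^ 2 * d)) * (L : ℝ) ^ d * ∑ p ∈ Finset.Icc 1 s, ((admissible p D).card : ℝ) *
              ((2 / (1 - Real.exp (-((κ / 2 - δ / 2 * ((D : ℝ) ^ 2 * Real.sqrt d)) / (p : ℕ) / Real.sqrt d))) *
                Real.exp ((κ / 2 - δ / 2 * ((D : ℝ) ^ 2 * Real.sqrt d)) / (p : ℕ) / Real.sqrt d)) ^ d) ^ (p - 1)) ^ (k + 1)) +
                        3 ^ (k + 1) * (2 ^ (k + 1) * ((∑ π ∈ setPartitions (univ : Finset (Fin (k + 1))), ((π.card - 1)! : ℝ)) *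
                            ((min 1 (2 * ((shrink L m w).card : ℝ) * Real.exp (-(b ^ 2 / 4)))) ^ ((2 * (k + 1) : ℕ) : ℝ)⁻¹ *
                              ((1 + Ku) ^ D * (Ac * (L : ℝ) ^ d * ∑ p ∈ Finset.Icc 1 s, ((admissible p D).card : ℝ) *
              ((2 / (1 - Real.exp (-(κ / 2 / (p : ℕ) / Real.sqrt d))) * Real.exp (κ / 2 / (p : ℕ) / Real.sqrt d)) ^ d) ^ (p - 1)) * momentConst D (2 * (k + 1)) K₀.toNNReal) ^ (k + 1))) +
                          (Ac * (L : ℝ) ^ d * ∑ p ∈ Finset.Icc 1 s, ((admissible p D).card : ℝ) *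
              ((2 / (1 - Real.exp (-(κ / 2 / (p : ℕ) / Real.sqrt d))) * Real.exp (κ / 2 / (p : ℕ) / Real.sqrt d)) ^ d) ^ (p - 1)) ^ (k + 1) * (2 ^ ((k + 1) * D) * 2 ^ 2 ^ ((k + 1) * D) *
                            ((((k + 1) * D : ℕ) : ℝ) * K₀ ^ ((k + 1) * D) * ε₃₁)))) / (k + 1)!) +
            ∑ k ∈ Finset.range t,
          ((2 ^ (k + 1) * (2 ^ ((k + 1) * D) * 2 ^ 2 ^ ((k + 1) * D) * K₀ ^ ((k + 1) * D)) *
          ((Ac * Real.exp (δ / 2 * ((D : ℝ) ^ 2 * d)) *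
              Real.exp (-((κ / 2 - δ / 2 * ((D : ℝ) ^ 2 * Real.sqrt d)) / 2 * w))) * J.card *
            ∑ p ∈ Finset.Icc 1 s, ((admissible p D).card : ℝ) *
              ((2 / (1 - Real.exp (-((κ / 2 - δ / 2 * ((D : ℝ) ^ 2 * Real.sqrt d)) / 2 / (p : ℕ) / Real.sqrt d))) *
                Real.exp ((κ / 2 - δ / 2 * ((D : ℝ) ^ 2 * Real.sqrt d)) / 2 / (p : ℕ) / Real.sqrt d)) ^ d) ^ (p - 1)) *
          (Ac * Real.exp (δ / 2 * ((D : ℝ) ^ 2 * d)) *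
            ((1 : ℝ) * (2 / (1 - Real.exp (-(δ / (2 * ((k + 1 : ℕ) : ℝ)) / Real.sqrt d))) * Real.exp (δ / (2 * ((k + 1 : ℕ) : ℝ)) / Real.sqrt d)) ^ d) *
            ∑ p ∈ Finset.Icc 1 s, ((admissible p D).card : ℝ) *
              ((2 / (1 - Real.exp (-((κ / 2 - δ / 2 * ((D : ℝ) ^ 2 * Real.sqrt d)) / (p : ℕ) / Real.sqrt d))) *
                Real.exp ((κ / 2 - δ / 2 * ((D : ℝ) ^ 2 * Real.sqrt d)) / (p : ℕ) / Real.sqrt d)) ^ d) ^ (p - 1)) ^ k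
          + 2 ^ (k + 1) * (2 ^ ((k + 1) * D) * 2 ^ 2 ^ ((k + 1) * D) * K₀ ^ ((k + 1) * D)) *
        ((J.image (boxIndex L)).card * (Ac * Real.exp (δ / 2 * ((D : ℝ) ^ 2 * d)) * Real.exp (-((κ / 2 - δ / 2 * ((D : ℝ) ^ 2 * Real.sqrt d)) / 2 * v)) *
          (L : ℝ) ^ d * ∑ p ∈ Finset.Icc 1 s, ((admissible p D).card : ℝ) *
              ((2 / (1 - Real.exp (-((κ / 2 - δ / 2 * ((D : ℝ) ^ 2 * Real.sqrt d)) / 2 / (p : ℕ) / Real.sqrt d))) *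
                Real.exp ((κ / 2 - δ / 2 * ((D : ℝ) ^ 2 * Real.sqrt d)) / 2 / (p : ℕ) / Real.sqrt d)) ^ d) ^ (p - 1))) *
        (Ac * Real.exp (δ / 2 * ((D : ℝ) ^ 2 * d)) *
          (2 / (1 - Real.exp (-(δ / (2 * ((k + 1 : ℕ) : ℝ)) / Real.sqrt d))) * Real.exp (δ / (2 * ((k + 1 : ℕ) : ℝ)) / Real.sqrt d)) ^ d *
          ∑ p ∈ Finset.Icc 1 s, ((admissible p D).card : ℝ) *
              ((2 / (1 - Real.exp (-((κ / 2 - δ / 2 * ((D : ℝ) ^ 2 * Real.sqrt d)) / (p : ℕ) / Real.sqrt d))) *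
                Real.exp ((κ / 2 - δ / 2 * ((D : ℝ) ^ 2 * Real.sqrt d)) / (p : ℕ) / Real.sqrt d)) ^ d) ^ (p - 1)) ^ k)
          + (2 ^ (k + 1) * (2 ^ ((k + 1) * D) * 2 ^ 2 ^ ((k + 1) * D) * K₀ ^ ((k + 1) * D)) *
          (Ac * Real.exp (δ / 2 * ((D : ℝ) ^ 2 * d)) * Real.exp (-((κ / 2 - δ / 2 * ((D : ℝ) ^ 2 * Real.sqrt d)) / 2 * w)) *
            (corridorsBar L w v (J.image (boxIndex L))).card * ∑ p ∈ Finset.Icc 1 s, ((admissible p D).card : ℝ) *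
              ((2 / (1 - Real.exp (-((κ / 2 - δ / 2 * ((D : ℝ) ^ 2 * Real.sqrt d)) / 2 / (p : ℕ) / Real.sqrt d))) *
                Real.exp ((κ / 2 - δ / 2 * ((D : ℝ) ^ 2 * Real.sqrt d)) / 2 / (p : ℕ) / Real.sqrt d)) ^ d) ^ (p - 1)) *
          (Ac * Real.exp (δ / 2 * ((D : ℝ) ^ 2 * d)) *
            (2 / (1 - Real.exp (-(δ / (2 * ((k + 1 : ℕ) : ℝ)) / Real.sqrt d))) * Real.exp (δ / (2 * ((k + 1 : ℕ) : ℝ)) / Real.sqrt d)) ^ d *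
            ∑ p ∈ Finset.Icc 1 s, ((admissible p D).card : ℝ) *
              ((2 / (1 - Real.exp (-((κ / 2 - δ / 2 * ((D : ℝ) ^ 2 * Real.sqrt d)) / (p : ℕ) / Real.sqrt d))) *
                Real.exp ((κ / 2 - δ / 2 * ((D : ℝ) ^ 2 * Real.sqrt d)) / (p : ℕ) / Real.sqrt d)) ^ d) ^ (p - 1)) ^ k
          + 2 ^ (k + 1) * (2 ^ ((k + 1) * D) * 2 ^ 2 ^ ((k + 1) * D) * K₀ ^ ((k + 1) * D)) *
        ((J.image (boxIndex L)).card * (Ac * Real.exp (δ / 2 * ((D : ℝ) ^ 2 * d)) * Real.exp (-((κ / 2 - δ / 2 * ((D : ℝ) ^ 2 * Real.sqrt d)) / 2 * v)) *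
          (L : ℝ) ^ d * ∑ p ∈ Finset.Icc 1 s, ((admissible p D).card : ℝ) *
              ((2 / (1 - Real.exp (-((κ / 2 - δ / 2 * ((D : ℝ) ^ 2 * Real.sqrt d)) / 2 / (p : ℕ) / Real.sqrt d))) *
                Real.exp ((κ / 2 - δ / 2 * ((D : ℝ) ^ 2 * Real.sqrt d)) / 2 / (p : ℕ) / Real.sqrt d)) ^ d) ^ (p - 1))) *
        (Ac * Real.exp (δ / 2 * ((D : ℝ) ^ 2 * d)) *
          (2 / (1 - Real.exp (-(δ / (2 * ((k + 1 : ℕ) : ℝ)) / Real.sqrt d))) * Real.exp (δ / (2 * ((k + 1 : ℕ) : ℝ)) / Real.sqrt d)) ^ d *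
          ∑ p ∈ Finset.Icc 1 s, ((admissible p D).card : ℝ) *
              ((2 / (1 - Real.exp (-((κ / 2 - δ / 2 * ((D : ℝ) ^ 2 * Real.sqrt d)) / (p : ℕ) / Real.sqrt d))) *
                Real.exp ((κ / 2 - δ / 2 * ((D : ℝ) ^ 2 * Real.sqrt d)) / (p : ℕ) / Real.sqrt d)) ^ d) ^ (p - 1)) ^ k)
          + 2 ^ ((k + 1) * D) * 2 ^ 2 ^ ((k + 1) * D) * K₀ ^ ((k + 1) * D) *
        ((J.image (boxIndex L)).card * (((k + 1 : ℕ) : ℝ) * (k : ℝ) *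
          ((Ac * Real.exp (δ / 2 * ((D : ℝ) ^ 2 * d)) * ((L : ℝ) ^ d * (2 / (1 - Real.exp (-(δ / (2 * ((k + 1 : ℕ) : ℝ)) / Real.sqrt d))) * Real.exp (δ / (2 * ((k + 1 : ℕ) : ℝ)) / Real.sqrt d)) ^ d) *
              ∑ p ∈ Finset.Icc 1 s, ((admissible p D).card : ℝ) *
              ((2 / (1 - Real.exp (-((κ / 2 - δ / 2 * ((D : ℝ) ^ 2 * Real.sqrt d)) / (p : ℕ) / Real.sqrt d))) *
                Real.exp ((κ / 2 - δ / 2 * ((D : ℝ) ^ 2 * Real.sqrt d)) / (p : ℕ) / Real.sqrt d)) ^ d) ^ (p - 1)) * ((Ac * Real.exp (δ / 2 * ((D : ℝ) ^ 2 * d)) * Real.exp (-(δ / (2 * ((k + 1 : ℕ) : ℝ)) / 2 * ((w : ℝ) + v + 1))) * ((L : ℝ) ^ d * (2 / (1 - Real.exp (-(δ / (2 * ((k + 1 : ℕ) : ℝ)) / 2 / Real.sqrt d))) * Real.exp (δ / (2 * ((k + 1 : ℕ) : ℝ)) / 2 / Real.sqrt d)) ^ d) *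
              ∑ p ∈ Finset.Icc 1 s, ((admissible p D).card : ℝ) *
              ((2 / (1 - Real.exp (-((κ / 2 - δ / 2 * ((D : ℝ) ^ 2 * Real.sqrt d)) / (p : ℕ) / Real.sqrt d))) *
                Real.exp ((κ / 2 - δ / 2 * ((D : ℝ) ^ 2 * Real.sqrt d)) / (p : ℕ) / Real.sqrt d)) ^ d) ^ (p - 1)) *
             (Ac * Real.exp (δ / 2 * ((D : ℝ) ^ 2 * d)) * ((L : ℝ) ^ d * (2 / (1 - Real.exp (-(δ / (2 * ((k + 1 : ℕ) : ℝ)) / Real.sqrt d))) * Real.exp (δ / (2 * ((k + 1 : ℕ) : ℝ)) / Real.sqrt d)) ^ d) *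
              ∑ p ∈ Finset.Icc 1 s, ((admissible p D).card : ℝ) *
              ((2 / (1 - Real.exp (-((κ / 2 - δ / 2 * ((D : ℝ) ^ 2 * Real.sqrt d)) / (p : ℕ) / Real.sqrt d))) *
                Real.exp ((κ / 2 - δ / 2 * ((D : ℝ) ^ 2 * Real.sqrt d)) / (p : ℕ) / Real.sqrt d)) ^ d) ^ (p - 1)) ^ (k - 1)))))
          + (J.image (boxIndex L)).card * ((3 : ℝ) ^ (k + 1) *
        (2 ^ ((k + 1) * D) * 2 ^ 2 ^ ((k + 1) * D) * K₀ ^ ((k + 1) * D) *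
            Real.exp (-(δ / 2 * ((v : ℝ) + 1))) *
          (Ac * Real.exp (δ / 2 * ((D : ℝ) ^ 2 * d)) * (L : ℝ) ^ d * ∑ p ∈ Finset.Icc 1 s, ((admissible p D).card : ℝ) *
              ((2 / (1 - Real.exp (-((κ / 2 - δ / 2 * ((D : ℝ) ^ 2 * Real.sqrt d)) / (p : ℕ) / Real.sqrt d))) *
                Real.exp ((κ / 2 - δ / 2 * ((D : ℝ) ^ 2 * Real.sqrt d)) / (p : ℕ) / Real.sqrt d)) ^ d) ^ (p - 1)) ^ (k + 1)))) / (k + 1)!)) := by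
  classical
  have hL : 0 < L := by omega
  have hγJ : 0 < γA - Jc := by linarith
  have hb0 : 0 ≤ b := zero_le_one.trans hb
  have hγb : 0 ≤ γ * b := mul_nonneg hγ0 hb0
  -- the displayed constants are non-negative (`Λ ≠ ∅`)
  have hV₂0 : 0 ≤ V₂ := const_nonneg_of_row hΛ (fun e e' => (Real.exp_pos _).le) hV₂
  have hM₂0 : 0 ≤ M₂ := const_nonneg_of_row hΛ (fun e e' => mul_nonneg (abs_nonneg _) (Real.exp_pos _).le) hM₂
  have hV₄0 : 0 ≤ V₄ := const_nonneg_of_row hΛ (fun e e' => by positivity) hV₄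
  have hc0 : 0 ≤ M₂ * V₄ / (γA - Jc) := div_nonneg (mul_nonneg hM₂0 hV₄0) hγJ.le
  have hKub : b ≤ Ku := by
    refine le_trans ?_ hKuI
    have : 0 ≤ M₂ * V₄ / (γA - Jc) * (γ + 1) * b := by positivity
    have hring : (1 + M₂ * V₄ / (γA - Jc) * (γ + 1)) * b = b + M₂ * V₄ / (γA - Jc) * (γ + 1) * b := by ring
    rw [hring]
    linarith
  have hKu : 0 ≤ Ku := hb0.trans hKub
  have hε₃₁ : 0 ≤ ε₃₁ := by
    refine le_trans ?_ hε₁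
    have h1 : 0 ≤ V₂ * M₂ / (γA - Jc) ^ 2 * Real.exp (-(θ / 2 * ((w - v : ℕ) : ℝ))) := by positivity
    have h2 : 0 ≤ Real.exp (-(θ * ((w - v : ℕ) : ℝ))) / (γA - Jc) := div_nonneg (Real.exp_pos _).le hγJ.le
    linarith
  have hK₀0 : 0 ≤ K₀ := zero_le_one.trans hK₀1
  -- every tessera of `B` meets `I`
  have hBI : ∀ m ∈ J.image (boxIndex L), ∃ x ∈ box L m, x ∈ I := by
    intro m hm
    obtain ⟨j, hj, rfl⟩ := Finset.mem_image.mp hm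
    exact ⟨j, mem_box_boxIndex hL j, hJI hj⟩
  -- the Euclidean weight feeds n08-w5's rows
  have hd0 : ∀ e : B1Eq324BenfattoLemma.Site d, (fun x y : B1Eq324BenfattoLemma.Site d => Real.sqrt (∑ j, (((x j : ℝ) - (y j : ℝ))) ^ 2)) e e = 0 := l2_self
  have hdsymm : ∀ e e' : B1Eq324BenfattoLemma.Site d, (fun x y : B1Eq324BenfattoLemma.Site d => Real.sqrt (∑ j, (((x j : ℝ) - (y j : ℝ))) ^ 2)) e e' =
      (fun x y : B1Eq324BenfattoLemma.Site d => Real.sqrt (∑ j, (((x j : ℝ) - (y j : ℝ))) ^ 2)) e' e := l2_comm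
  have hdtri : ∀ e e' e'' : B1Eq324BenfattoLemma.Site d, (fun x y : B1Eq324BenfattoLemma.Site d => Real.sqrt (∑ j, (((x j : ℝ) - (y j : ℝ))) ^ 2)) e e'' ≤
      (fun x y : B1Eq324BenfattoLemma.Site d => Real.sqrt (∑ j, (((x j : ℝ) - (y j : ℝ))) ^ 2)) e e' +
      (fun x y : B1Eq324BenfattoLemma.Site d => Real.sqrt (∑ j, (((x j : ℝ) - (y j : ℝ))) ^ 2)) e' e'' := fun e e' e'' => l2_triangle e e' e''
  have hl2 : ∀ x y : B1Eq324BenfattoLemma.Site d, Real.sqrt (∑ j, (((x j : ℝ) - (y j : ℝ))) ^ 2) ≤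
      (fun x y : B1Eq324BenfattoLemma.Site d => Real.sqrt (∑ j, (((x j : ℝ) - (y j : ℝ))) ^ 2)) x y := fun x y => le_rfl
  -- rows (a)–(f)
  have huI : ∀ ξ ∈ smallFieldOn (corridors L w (J.image (boxIndex L)) : Set (B1Eq324BenfattoLemma.Site d)) I (γ * b),
      ξ ∈ smallFieldOn ((C : Finset (B1Eq324BenfattoLemma.Site d)) : Set (B1Eq324BenfattoLemma.Site d)) I b →
      ∀ y ∈ I, |condMean K (C ∪ corridors L w (J.image (boxIndex L))) ξ y| ≤ Ku := by
    intro ξ hξ hξC y hy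
    by_cases hyC : y ∈ C
    · -- on `C` the centre is the datum, `b`-small at `d(Δ_y, I) = 0`
      have hA' : A.PosDef := posDef_of_coercive hAs hγA0 hγA
      rw [condMean_apply_of_mem K (C ∪ corridors L w (J.image (boxIndex L))) ξ
        (isUnit_det_covGram_kernel hK hA' (Finset.union_subset hCΛ hΓΛ)) (Finset.mem_union_left _ hyC)]
      have h1 := hξC y (Finset.mem_coe.mpr hyC)
      rw [B1Eq324BenfattoSect5SlotMoments.distToRegion_eq_zero_of_mem hy, add_zero, mul_one] at h1
      exact h1.trans hKub
    · have h := abs_condMean_union_le_on_region hK hAs hγA0 hγA hd0 hdsymm hdtri hJc hθ.le hJcγ hl2 hM₂ hV₄ hΛ hCΛ hΓΛ hγ0 hb0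
        (R := 0) ξ hξ hξC y hy hyC (fun c _ => Real.sqrt_nonneg _)
      rw [mul_zero, neg_zero, Real.exp_zero] at h
      refine h.trans (le_trans ?_ hKuI)
      have hγb' : γ * b ≤ b := by nlinarith
      have hring : (1 + M₂ * V₄ / (γA - Jc) * (γ + 1)) * b = b + M₂ * V₄ / (γA - Jc) * (γ + 1) * b := by ring
      rw [hring]
      linarith
  have hKR : ∀ m ∈ (J.image (boxIndex L)), ∀ x y, |Kb m x y| ≤ K₀ := fun m hm x y =>
    (abs_partKernel_le hBΛ hKb hAs hγA0 hγA hd0 hdsymm hdtri hJc hθ.le hJcγ hl2 m hm x y).trans hK₀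
  have hKrR : ∀ x y, |K x y| ≤ K₀ := fun x y =>
    (abs_kernel_le hK hAs hγA0 hγA hd0 hdsymm hdtri hJc hθ.le hJcγ hl2 x y).trans hK₀
  have hKdec : ∀ x y : B1Eq324BenfattoLemma.Site d, |K x y| ≤ K₀ * Real.exp (-(θ / Real.sqrt d * ∑ jj, |((x jj : ℝ) - (y jj : ℝ))|)) :=
    fun x y => (abs_kernel_le_exp_l1 hK hAs hγA0 hγA hd0 hdsymm hdtri hJc hθ.le hJcγ hl2 x y).trans
      (mul_le_mul_of_nonneg_right hK₀ (Real.exp_pos _).le)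
  have hdec : ∀ m ∈ (J.image (boxIndex L)), ∀ x y : B1Eq324BenfattoLemma.Site d,
      |Kb m x y| ≤ K₀ * Real.exp (-(θ / Real.sqrt d * ∑ jj, |((x jj : ℝ) - (y jj : ℝ))|)) := fun m hm x y =>
    (abs_partKernel_le_exp_l1 hBΛ hKb hAs hγA0 hγA hd0 hdsymm hdtri hJc hθ.le hJcγ hl2 m hm x y).trans
      (mul_le_mul_of_nonneg_right hK₀ (Real.exp_pos _).le)
  have huε : ∀ m ∈ (J.image (boxIndex L)), ∀ ξ ∈ smallFieldOn (corridors L w (J.image (boxIndex L)) : Set (B1Eq324BenfattoLemma.Site d)) I (γ * b),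
      ξ ∈ smallFieldOn ((C : Finset (B1Eq324BenfattoLemma.Site d)) : Set (B1Eq324BenfattoLemma.Site d)) I b →
      ∀ x ∈ shrink L m (w + (w - v)), |condMean K (C ∪ corridors L w (J.image (boxIndex L))) ξ x| ≤ ε₃₁ :=
    fun m hm ξ hξ hξC x hx =>
      (abs_condMean_union_le_deep hK hAs hγA0 hγA hd0 hdsymm hdtri hJc hθ.le hJcγ hl2 hM₂ hV₄ hL hBΛ hCΛ hΓΛ hCsh hγ0 hb0
        m hm (hBI m hm) ξ hξ hξC x hx
        (fun c hc => hCfar m hm x (shrink_subset_box L m w (shrink_mono L m (Nat.le_add_right w (w - v)) hx)) c hc)).trans hε₂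
  have hKε : ∀ m ∈ (J.image (boxIndex L)), ∀ x ∈ shrink L m (w + (w - v)), ∀ y, |Kb m x y - K x y| ≤ ε₃₁ :=
    abs_partKernel_sub_kernel_le_of_le hK hBΛ hKb hAs hγA0 hγA hd0 hdsymm hdtri hJc hθ.le hJcγ hl2 hV₂ hM₂ hε₁
  have hvar : ∀ m ∈ (J.image (boxIndex L)), ∀ x ∈ shrink L m w, Kb m x x ≤ 1 / 2 :=
    partKernel_self_le_half hBΛ hKb hAs hγA0 hγA hhalf
  have hm : ∀ m ∈ (J.image (boxIndex L)), ∀ ξ ∈ smallFieldOn (corridors L w (J.image (boxIndex L)) : Set (B1Eq324BenfattoLemma.Site d)) I (γ * b),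
      ξ ∈ smallFieldOn ((C : Finset (B1Eq324BenfattoLemma.Site d)) : Set (B1Eq324BenfattoLemma.Site d)) I b →
      ∀ x ∈ shrink L m w, |condMean K (C ∪ corridors L w (J.image (boxIndex L))) ξ x| ≤ 1 / 2 * b * (1 + distToRegion I x) := by
    intro m hm ξ hξ hξC x hx
    refine (abs_condMean_union_le_profile_on_shrink hK hAs hγA0 hγA hd0 hdsymm hdtri hJc hθ.le hJcγ hl2 hM₂ hV₄ hL hBΛ hCΛ hΓΛ hCsh hγ0 hb0
      m hm ξ hξ hξC x hx (fun c hc => hCfar m hm x (shrink_subset_box L m w hx) c hc)).trans ?_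
    have h1 : 0 ≤ 1 + distToRegion I x := by linarith [B1Eq324BenfattoAppendixA.distToRegion_nonneg I x]
    exact mul_le_mul_of_nonneg_right (mul_le_mul_of_nonneg_right hsmallU hb0) h1
  -- the step
  obtain ⟨u, Err, hbox, hE, hErr⟩ := exists_upper_step hK hAs hγA0 hγA hΓΛ hBΛ hKb hκ hJ hJI hAc0 hA hL2 hv hb hγ1 hsmall hCΛ hCsh
    hKu hKuK hK₀1 hε₃₁ huI hKR hKrR hKdec hdec huε hKε hvar hm hδ hδle hres t (s := s) (D := D)
  refine ⟨u, hbox, ?_⟩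
  have hsum : ∑ m ∈ (J.image (boxIndex L)), Err m = _ := Finset.sum_congr rfl fun m _ => hErr m
  rw [hsum] at hE
  exact hE

end Standard

end Literature.MathematicalPhysics.QuantumFieldTheory.Balaban1983to89.B1Eq324BenfattoKernelSect5ClassUpperStep

end
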